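import Summits.AtomisticToContinuum.Crystallization.Theorems.TwoCentreKissingKernelRobustTangencyBoundPentagonSystem
import Summits.AtomisticToContinuum.Crystallization.Theorems.TwoCentreKissingKernelRobustTangencyBoundRhombusIsolated
import Literature.Geometry.DiscreteGeometry.SphericalCodeHemisphere
import HarnessLib

/-!
# `RobustTangencyBound` — no isolated soft pentagon (robust Bezdek–Reid Lemma 5; step (III))

Route `TwoCentreKissingKernel`, item `stmt-AtomisticToContinuum-12082`, blueprint (III) §5–7.  In the hull of a finite set `X` of unit
vectors with `0 ∈ interior (conv X)` and distinct points at inner product `≤ 1/2 + 2η`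
(`0 ≤ η ≤ 10⁻³`), let `p₁ … p₅ ∈ X` span a soft pentagon — the five sides
`⟪p₁,p₂⟫, ⟪p₂,p₃⟫, ⟪p₃,p₄⟫, ⟪p₄,p₅⟫, ⟪p₅,p₁⟫ ≥ 1/2 − 3η` — fan-triangulated from `p₁` by facets
`{p₁,p₂,p₃}`, `{p₁,p₃,p₄}`, `{p₁,p₄,p₅}`.  If every OTHER facet through `p₂`, through `p₅` and
through `p₁` is a soft triangle, we reach a contradiction (`false_of_isolated_soft_pentagon`): the
diagonals `x₁ = ⟪p₁,p₃⟫`, `x₂ = ⟪p₁,p₄⟫`, the sides and the regular corners' cosines/sines solve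
`pentClaim m₂ m₅ m₁` in its box, which the 216 kernel certificates exclude.  Same translation as
`…RhombusIsolated.lean`; the new ingredient is the diagonal window `⟪p₁,p₃⟫ ≥ −0.51`
(`inner_diag_ge_of_soft`, from `inner_mul_inner_sub_sqrt_le`).
-/

noncomputable section

namespace Summit.AtomisticToContinuum.Crystallization.Theorems

open Real RealInnerProductSpace InnerProductGeometry Literature.Geometry.DiscreteGeometry
  Literature.Analysis.ValidatedNumerics Finset

/-- **A diagonal across a soft corner is not too long**: if `u, w` are soft neighbours of the unit
vector `v` (`⟪v,u⟫, ⟪v,w⟫ ∈ [0.497, 0.502]`) then `⟪u, w⟫ ≥ −0.51` (the angle `∠(u,w)` is at most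
`∠(u,v) + ∠(v,w) ≤ 120.4°`). -/
theorem inner_diag_ge_of_soft {v u w : EuclideanSpace ℝ (Fin 3)} (hv : ‖v‖ = 1) (hu : ‖u‖ = 1)
    (hw : ‖w‖ = 1) (ha1 : 497 / 1000 ≤ ⟪v, u⟫) (ha2 : ⟪v, u⟫ ≤ 502 / 1000)
    (hb1 : 497 / 1000 ≤ ⟪v, w⟫) (hb2 : ⟪v, w⟫ ≤ 502 / 1000) : -51 / 100 ≤ ⟪u, w⟫ := by
  have h := inner_mul_inner_sub_sqrt_le hv hu hw
  have hab : 497 / 1000 * (497 / 1000) ≤ ⟪v, u⟫ * ⟪v, w⟫ :=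
    mul_le_mul ha1 hb1 (by norm_num) (by linarith)
  have hs : Real.sqrt (1 - ⟪v, u⟫ ^ 2) * Real.sqrt (1 - ⟪v, w⟫ ^ 2) ≤ 753 / 1000 := by
    have h1 : 1 - ⟪v, u⟫ ^ 2 ≤ (753 / 1000 : ℝ) := by nlinarith
    have h2 : 1 - ⟪v, w⟫ ^ 2 ≤ 1 := by nlinarith
    have h0 : 0 ≤ 1 - ⟪v, u⟫ ^ 2 := by nlinarith
    rw [← Real.sqrt_mul h0]
    calc Real.sqrt ((1 - ⟪v, u⟫ ^ 2) * (1 - ⟪v, w⟫ ^ 2))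
        ≤ Real.sqrt ((753 / 1000) * (753 / 1000)) := by
          apply Real.sqrt_le_sqrt
          have : 1 - ⟪v, w⟫ ^ 2 ≤ 753 / 1000 := by nlinarith
          exact mul_le_mul h1 this (by nlinarith) (by norm_num)
      _ = 753 / 1000 := by rw [Real.sqrt_mul_self (by norm_num)]
  linarith

/-- An inner product in the soft/separation window has square `< 1`. -/
theorem sq_lt_one_of_window {t η : ℝ} (hη0 : 0 ≤ η) (hη : η ≤ 1 / 1000) (h1 : 1 / 2 - 3 * η ≤ t)
    (h2 : t ≤ 1 / 2 + 2 * η) : t ^ 2 < 1 := by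
  have ht0 : 0 ≤ t := by linarith
  have ht1 : t < 1 := by linarith
  calc t ^ 2 = t * t := pow_two t
    _ < 1 := by nlinarith

/-- The corner angle of a triangular facet `{y, u, w}` at `y` is `∠(t_y u, t_y w)`. -/
theorem cornerAngle_triangle {X : Finset (EuclideanSpace ℝ (Fin 3))} (hX1 : ∀ z ∈ X, ‖z‖ = 1)
    (h0 : (0 : EuclideanSpace ℝ (Fin 3)) ∈ interior (convexHull ℝ (X : Set (EuclideanSpace ℝ (Fin 3)))))
    {c y u w : EuclideanSpace ℝ (Fin 3)} (hcF : c ∈ facetNormals X) (hT : tightSet X c = {y, u, w})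
    (hyu : y ≠ u) (hyw : y ≠ w) (huw : u ≠ w) :
    cornerAngle X c y = angle (perpTo y u) (perpTo y w) := by
  rw [cornerAngle, ballFraction_dirCone_triangle hX1 h0 hcF hT hyu hyw huw,
    mul_div_cancel₀ _ (by positivity)]

/-- **No isolated soft pentagon** (robust Bezdek–Reid Lemma 5). See the module docstring. -/
theorem false_of_isolated_soft_pentagon {X : Finset (EuclideanSpace ℝ (Fin 3))}
    (hX1 : ∀ z ∈ X, ‖z‖ = 1)
    (h0 : (0 : EuclideanSpace ℝ (Fin 3)) ∈ interior (convexHull ℝ (X : Set (EuclideanSpace ℝ (Fin 3)))))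
    {η : ℝ} (hη0 : 0 ≤ η) (hη : η ≤ 1 / 1000)
    (hsep : ∀ p ∈ X, ∀ q ∈ X, p ≠ q → ⟪p, q⟫ ≤ 1 / 2 + 2 * η)
    {p₁ p₂ p₃ p₄ p₅ : EuclideanSpace ℝ (Fin 3)} (hp₁ : p₁ ∈ X) (hp₂ : p₂ ∈ X) (hp₃ : p₃ ∈ X)
    (hp₄ : p₄ ∈ X) (hp₅ : p₅ ∈ X)
    (h12 : p₁ ≠ p₂) (h13 : p₁ ≠ p₃) (h14 : p₁ ≠ p₄) (h15 : p₁ ≠ p₅) (h23 : p₂ ≠ p₃)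
    (h24 : p₂ ≠ p₄) (h25 : p₂ ≠ p₅) (h34 : p₃ ≠ p₄) (h35 : p₃ ≠ p₅) (h45 : p₄ ≠ p₅)
    (s12 : 1 / 2 - 3 * η ≤ ⟪p₁, p₂⟫) (s23 : 1 / 2 - 3 * η ≤ ⟪p₂, p₃⟫) (s34 : 1 / 2 - 3 * η ≤ ⟪p₃, p₄⟫)
    (s45 : 1 / 2 - 3 * η ≤ ⟪p₄, p₅⟫) (s51 : 1 / 2 - 3 * η ≤ ⟪p₅, p₁⟫)
    {c₁₂₃ c₁₃₄ c₁₄₅ : EuclideanSpace ℝ (Fin 3)}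
    (hc₁₂₃ : c₁₂₃ ∈ facetNormals X) (hT₁₂₃ : tightSet X c₁₂₃ = {p₁, p₂, p₃})
    (hc₁₃₄ : c₁₃₄ ∈ facetNormals X) (hT₁₃₄ : tightSet X c₁₃₄ = {p₁, p₃, p₄})
    (hc₁₄₅ : c₁₄₅ ∈ facetNormals X) (hT₁₄₅ : tightSet X c₁₄₅ = {p₁, p₄, p₅})
    (hreg2 : ∀ c' ∈ facetNormals X, ⟪c', p₂⟫ = 1 → c' ≠ c₁₂₃ → SoftTriangleAt η X c' p₂)
    (hreg5 : ∀ c' ∈ facetNormals X, ⟪c', p₅⟫ = 1 → c' ≠ c₁₄₅ → SoftTriangleAt η X c' p₅)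
    (hreg1 : ∀ c' ∈ facetNormals X, ⟪c', p₁⟫ = 1 → c' ≠ c₁₂₃ → c' ≠ c₁₃₄ → c' ≠ c₁₄₅ →
      SoftTriangleAt η X c' p₁) : False := by
  classical
  -- windows of the base quantities
  have u12 := hsep p₁ hp₁ p₂ hp₂ h12
  have u23 := hsep p₂ hp₂ p₃ hp₃ h23
  have u34 := hsep p₃ hp₃ p₄ hp₄ h34
  have u45 := hsep p₄ hp₄ p₅ hp₅ h45
  have u51 := hsep p₅ hp₅ p₁ hp₁ h15.symm
  have ux1 : ⟪p₁, p₃⟫ ≤ 1 / 2 + 2 * η := hsep p₁ hp₁ p₃ hp₃ h13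
  have ux2 : ⟪p₁, p₄⟫ ≤ 1 / 2 + 2 * η := hsep p₁ hp₁ p₄ hp₄ h14
  have lx1 : -51 / 100 ≤ ⟪p₁, p₃⟫ := by
    have e1 : ⟪p₂, p₁⟫ = ⟪p₁, p₂⟫ := real_inner_comm _ _
    exact inner_diag_ge_of_soft (hX1 _ hp₂) (hX1 _ hp₁) (hX1 _ hp₃) (by rw [e1]; linarith)
      (by rw [e1]; linarith) (by linarith) (by linarith)
  have lx2 : -51 / 100 ≤ ⟪p₁, p₄⟫ := by
    have e1 : ⟪p₅, p₄⟫ = ⟪p₄, p₅⟫ := real_inner_comm _ _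
    have := inner_diag_ge_of_soft (hX1 _ hp₅) (hX1 _ hp₄) (hX1 _ hp₁) (by rw [e1]; linarith)
      (by rw [e1]; linarith) (by linarith) (by linarith)
    rwa [real_inner_comm] at this
  -- facets through `p₂`, `p₅`, `p₁`
  have m1T123 : p₁ ∈ tightSet X c₁₂₃ := by rw [hT₁₂₃]; simp
  have m2T123 : p₂ ∈ tightSet X c₁₂₃ := by rw [hT₁₂₃]; simp
  have m3T134 : p₃ ∈ tightSet X c₁₃₄ := by rw [hT₁₃₄]; simp
  have m1T134 : p₁ ∈ tightSet X c₁₃₄ := by rw [hT₁₃₄]; simp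
  have m1T145 : p₁ ∈ tightSet X c₁₄₅ := by rw [hT₁₄₅]; simp
  have m5T145 : p₅ ∈ tightSet X c₁₄₅ := by rw [hT₁₄₅]; simp
  have hne12 : c₁₂₃ ≠ c₁₃₄ := by
    intro h
    have : p₂ ∈ tightSet X c₁₃₄ := h ▸ m2T123
    rw [hT₁₃₄, mem_insert, mem_insert, mem_singleton] at this
    rcases this with h | h | h
    · exact h12 h.symm
    · exact h23 h
    · exact h24 h
  have hne13 : c₁₂₃ ≠ c₁₄₅ := by
    intro h
    have : p₂ ∈ tightSet X c₁₄₅ := h ▸ m2T123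
    rw [hT₁₄₅, mem_insert, mem_insert, mem_singleton] at this
    rcases this with h | h | h
    · exact h12 h.symm
    · exact h24 h
    · exact h25 h
  have hne23 : c₁₃₄ ≠ c₁₄₅ := by
    intro h
    have : p₃ ∈ tightSet X c₁₄₅ := h ▸ m3T134
    rw [hT₁₄₅, mem_insert, mem_insert, mem_singleton] at this
    rcases this with h | h | h
    · exact h13 h.symm
    · exact h34 h
    · exact h35 h
  set S2 := (facetNormals X).filter (fun c' => ⟪c', p₂⟫ = 1) with hS2
  set S5 := (facetNormals X).filter (fun c' => ⟪c', p₅⟫ = 1) with hS5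
  set S1 := (facetNormals X).filter (fun c' => ⟪c', p₁⟫ = 1) with hS1
  have hc2 : c₁₂₃ ∈ S2 := mem_filter.2 ⟨hc₁₂₃, (mem_tightSet.1 m2T123).2⟩
  have hc5 : c₁₄₅ ∈ S5 := mem_filter.2 ⟨hc₁₄₅, (mem_tightSet.1 m5T145).2⟩
  have hc1a : c₁₂₃ ∈ S1 := mem_filter.2 ⟨hc₁₂₃, (mem_tightSet.1 m1T123).2⟩
  have hc1b : c₁₃₄ ∈ S1.erase c₁₂₃ :=
    mem_erase.2 ⟨hne12.symm, mem_filter.2 ⟨hc₁₃₄, (mem_tightSet.1 m1T134).2⟩⟩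
  have hc1c : c₁₄₅ ∈ (S1.erase c₁₂₃).erase c₁₃₄ :=
    mem_erase.2 ⟨hne23.symm, mem_erase.2 ⟨hne13.symm, mem_filter.2 ⟨hc₁₄₅, (mem_tightSet.1 m1T145).2⟩⟩⟩
  set R2 := S2.erase c₁₂₃ with hR2
  set R5 := S5.erase c₁₄₅ with hR5
  set R1 := ((S1.erase c₁₂₃).erase c₁₃₄).erase c₁₄₅ with hR1
  have hR2sub : R2 ⊆ S2 := erase_subset _ _
  have hR5sub : R5 ⊆ S5 := erase_subset _ _
  have hR1sub : R1 ⊆ S1 := ((erase_subset _ _).trans (erase_subset _ _)).trans (erase_subset _ _)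
  have hR2reg : ∀ c' ∈ R2, SoftTriangleAt η X c' p₂ := by
    intro c' hc'
    obtain ⟨h1, hS⟩ := mem_erase.1 hc'
    obtain ⟨hF, hcy⟩ := mem_filter.1 hS
    exact hreg2 c' hF hcy h1
  have hR5reg : ∀ c' ∈ R5, SoftTriangleAt η X c' p₅ := by
    intro c' hc'
    obtain ⟨h1, hS⟩ := mem_erase.1 hc'
    obtain ⟨hF, hcy⟩ := mem_filter.1 hS
    exact hreg5 c' hF hcy h1
  have hR1reg : ∀ c' ∈ R1, SoftTriangleAt η X c' p₁ := by
    intro c' hc'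
    obtain ⟨h3, hc''⟩ := mem_erase.1 hc'
    obtain ⟨h2, hc'''⟩ := mem_erase.1 hc''
    obtain ⟨h1, hS⟩ := mem_erase.1 hc'''
    obtain ⟨hF, hcy⟩ := mem_filter.1 hS
    exact hreg1 c' hF hcy h1 h2 h3
  have hm2 : R2.toList.length ≤ 5 := by
    rw [length_toList]; exact card_le_five_of_softTriangles hX1 h0 hη0 hη hsep hp₂ hR2sub hR2reg
  have hm5 : R5.toList.length ≤ 5 := by
    rw [length_toList]; exact card_le_five_of_softTriangles hX1 h0 hη0 hη hsep hp₅ hR5sub hR5reg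
  have hm1 : R1.toList.length ≤ 5 := by
    rw [length_toList]; exact card_le_five_of_softTriangles hX1 h0 hη0 hη hsep hp₁ hR1sub hR1reg
  -- windows of the regular corners
  have hw2 : ∀ c' ∈ R2.toList,
      InIvl ((3252 : ℚ) / 10000, (3415 : ℚ) / 10000) (Real.cos (cornerAngle X c' p₂)) ∧
      InIvl ((9398 : ℚ) / 10000, (9457 : ℚ) / 10000) (Real.sin (cornerAngle X c' p₂)) := fun c' hc' =>
    (window_of_softTriangleAt hX1 h0 hη0 hη hsep (mem_filter.1 (hR2sub (mem_toList.1 hc'))).1 hp₂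
      (hR2reg c' (mem_toList.1 hc'))).1
  have hw5 : ∀ c' ∈ R5.toList,
      InIvl ((3252 : ℚ) / 10000, (3415 : ℚ) / 10000) (Real.cos (cornerAngle X c' p₅)) ∧
      InIvl ((9398 : ℚ) / 10000, (9457 : ℚ) / 10000) (Real.sin (cornerAngle X c' p₅)) := fun c' hc' =>
    (window_of_softTriangleAt hX1 h0 hη0 hη hsep (mem_filter.1 (hR5sub (mem_toList.1 hc'))).1 hp₅
      (hR5reg c' (mem_toList.1 hc'))).1
  have hw1 : ∀ c' ∈ R1.toList,
      InIvl ((3252 : ℚ) / 10000, (3415 : ℚ) / 10000) (Real.cos (cornerAngle X c' p₁)) ∧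
      InIvl ((9398 : ℚ) / 10000, (9457 : ℚ) / 10000) (Real.sin (cornerAngle X c' p₁)) := fun c' hc' =>
    (window_of_softTriangleAt hX1 h0 hη0 hη hsep (mem_filter.1 (hR1sub (mem_toList.1 hc'))).1 hp₁
      (hR1reg c' (mem_toList.1 hc'))).1
  -- the vertex conditions in product form, split off the cluster facets
  set z : EuclideanSpace ℝ (Fin 3) → EuclideanSpace ℝ (Fin 3) → ℂ :=
    fun c' y => (Real.cos (cornerAngle X c' y) : ℂ) + (Real.sin (cornerAngle X c' y) : ℂ) * Complex.I
    with hz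
  have hprod2 : z c₁₂₃ p₂ * (R2.toList.map fun c' => z c' p₂).prod = 1 := by
    have h := vertex_product_eq_one hX1 h0 hp₂
    rw [← mul_prod_erase S2 _ hc2] at h
    rw [prod_map_toList]; exact h
  have hprod5 : z c₁₄₅ p₅ * (R5.toList.map fun c' => z c' p₅).prod = 1 := by
    have h := vertex_product_eq_one hX1 h0 hp₅
    rw [← mul_prod_erase S5 _ hc5] at h
    rw [prod_map_toList]; exact h
  have hprod1 : z c₁₂₃ p₁ * (z c₁₃₄ p₁ * (z c₁₄₅ p₁ * (R1.toList.map fun c' => z c' p₁).prod)) = 1 := by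
    have h := vertex_product_eq_one hX1 h0 hp₁
    rw [← mul_prod_erase S1 _ hc1a, ← mul_prod_erase (S1.erase c₁₂₃) _ hc1b,
      ← mul_prod_erase ((S1.erase c₁₂₃).erase c₁₃₄) _ hc1c] at h
    rw [prod_map_toList]; exact h
  -- the five cluster corners in forward form
  have q12 : ⟪p₁, p₂⟫ ^ 2 < 1 := sq_lt_one_of_window hη0 hη s12 u12
  have q23 : ⟪p₂, p₃⟫ ^ 2 < 1 := sq_lt_one_of_window hη0 hη s23 u23
  have q51 : ⟪p₅, p₁⟫ ^ 2 < 1 := sq_lt_one_of_window hη0 hη s51 u51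
  have q45 : ⟪p₄, p₅⟫ ^ 2 < 1 := sq_lt_one_of_window hη0 hη s45 u45
  have q13 : ⟪p₁, p₃⟫ ^ 2 < 1 := by nlinarith only [lx1, ux1, hη]
  have q14 : ⟪p₁, p₄⟫ ^ 2 < 1 := by nlinarith only [lx2, ux2, hη]
  have q15 : ⟪p₁, p₅⟫ ^ 2 < 1 := by rw [real_inner_comm]; exact q51
  have q21 : ⟪p₂, p₁⟫ ^ 2 < 1 := by rw [real_inner_comm]; exact q12
  have q54 : ⟪p₅, p₄⟫ ^ 2 < 1 := by rw [real_inner_comm]; exact q45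
  have hT2 : tightSet X c₁₂₃ = {p₂, p₁, p₃} := by rw [hT₁₂₃]; exact Finset.insert_comm p₁ p₂ {p₃}
  have hT5 : tightSet X c₁₄₅ = {p₅, p₄, p₁} := by
    rw [hT₁₄₅]; ext t; simp only [mem_insert, mem_singleton]; tauto
  have hθ2 : cornerAngle X c₁₂₃ p₂ = angle (perpTo p₂ p₁) (perpTo p₂ p₃) :=
    cornerAngle_triangle hX1 h0 hc₁₂₃ hT2 h12.symm h23 h13
  have hθ5 : cornerAngle X c₁₄₅ p₅ = angle (perpTo p₅ p₄) (perpTo p₅ p₁) :=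
    cornerAngle_triangle hX1 h0 hc₁₄₅ hT5 h45.symm h15.symm h14.symm
  have hθ1a : cornerAngle X c₁₂₃ p₁ = angle (perpTo p₁ p₂) (perpTo p₁ p₃) :=
    cornerAngle_triangle hX1 h0 hc₁₂₃ hT₁₂₃ h12 h13 h23
  have hθ1b : cornerAngle X c₁₃₄ p₁ = angle (perpTo p₁ p₃) (perpTo p₁ p₄) :=
    cornerAngle_triangle hX1 h0 hc₁₃₄ hT₁₃₄ h13 h14 h34
  have hθ1c : cornerAngle X c₁₄₅ p₁ = angle (perpTo p₁ p₄) (perpTo p₁ p₅) :=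
    cornerAngle_triangle hX1 h0 hc₁₄₅ hT₁₄₅ h14 h15 h45
  obtain ⟨C2, Sn2⟩ := corner_forward (hX1 _ hp₂) (hX1 _ hp₁) (hX1 _ hp₃) q21 q23
  obtain ⟨C5, Sn5⟩ := corner_forward (hX1 _ hp₅) (hX1 _ hp₄) (hX1 _ hp₁) q54 q51
  obtain ⟨C1a, Sn1a⟩ := corner_forward (hX1 _ hp₁) (hX1 _ hp₂) (hX1 _ hp₃) q12 q13
  obtain ⟨C1b, Sn1b⟩ := corner_forward (hX1 _ hp₁) (hX1 _ hp₃) (hX1 _ hp₄) q13 q14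
  obtain ⟨C1c, Sn1c⟩ := corner_forward (hX1 _ hp₁) (hX1 _ hp₄) (hX1 _ hp₅) q14 q15
  -- the candidate point and the evaluation of the cluster corners
  obtain ⟨e0, e1, e2, e3, e4, e5, e6⟩ := pentPt_base ⟪p₁, p₃⟫ ⟪p₁, p₄⟫ ⟪p₁, p₂⟫ ⟪p₂, p₃⟫ ⟪p₃, p₄⟫
    ⟪p₄, p₅⟫ ⟪p₅, p₁⟫ R2.toList R5.toList R1.toList
    (fun c' => Real.cos (cornerAngle X c' p₂)) (fun c' => Real.sin (cornerAngle X c' p₂))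
    (fun c' => Real.cos (cornerAngle X c' p₅)) (fun c' => Real.sin (cornerAngle X c' p₅))
    (fun c' => Real.cos (cornerAngle X c' p₁)) (fun c' => Real.sin (cornerAngle X c' p₁))
  set pt := pentPt ⟪p₁, p₃⟫ ⟪p₁, p₄⟫ ⟪p₁, p₂⟫ ⟪p₂, p₃⟫ ⟪p₃, p₄⟫ ⟪p₄, p₅⟫ ⟪p₅, p₁⟫
    R2.toList R5.toList R1.toList
    (fun c' => Real.cos (cornerAngle X c' p₂)) (fun c' => Real.sin (cornerAngle X c' p₂))
    (fun c' => Real.cos (cornerAngle X c' p₅)) (fun c' => Real.sin (cornerAngle X c' p₅))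
    (fun c' => Real.cos (cornerAngle X c' p₁)) (fun c' => Real.sin (cornerAngle X c' p₁)) with hpt
  have hz2 : zOf pt pent2R = z c₁₂₃ p₂ := by
    rw [pent2R, zOf_cornerR, hz]
    have ea : ⟪p₂, p₁⟫ = ⟪p₁, p₂⟫ := real_inner_comm _ _
    simp only [RExpr.eval, e0, e2, e3, hθ2, C2, Sn2, ea]
    push_cast; ring_nf
  have hz5 : zOf pt pent5R = z c₁₄₅ p₅ := by
    rw [pent5R, zOf_cornerR, hz]
    have ea : ⟪p₄, p₁⟫ = ⟪p₁, p₄⟫ := real_inner_comm _ _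
    have eb : ⟪p₅, p₄⟫ = ⟪p₄, p₅⟫ := real_inner_comm _ _
    simp only [RExpr.eval, e1, e5, e6, hθ5, C5, Sn5, ea, eb]
    push_cast; ring_nf
  have hz1a : zOf pt pentA1R = z c₁₂₃ p₁ := by
    rw [pentA1R, zOf_cornerR, hz]
    simp only [RExpr.eval, e0, e2, e3, hθ1a, C1a, Sn1a]
    push_cast; ring_nf
  have hz1b : zOf pt pentB1R = z c₁₃₄ p₁ := by
    rw [pentB1R, zOf_cornerR, hz]
    simp only [RExpr.eval, e0, e1, e4, hθ1b, C1b, Sn1b]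
    push_cast; ring_nf
  have hz1c : zOf pt pentC1R = z c₁₄₅ p₁ := by
    rw [pentC1R, zOf_cornerR, hz]
    have ea : ⟪p₅, p₁⟫ = ⟪p₁, p₅⟫ := real_inner_comm _ _
    simp only [RExpr.eval, e1, e5, e6, hθ1c, C1c, Sn1c, ea]
    push_cast; ring_nf
  rw [← hz2] at hprod2
  rw [← hz5] at hprod5
  rw [← hz1a, ← hz1b, ← hz1c] at hprod1
  -- the algebraic core
  have iv : ∀ {t : ℝ}, 1 / 2 - 3 * η ≤ t → t ≤ 1 / 2 + 2 * η →
      InIvl ((497 : ℚ) / 1000, (502 : ℚ) / 1000) t := fun h1 h2 => by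
    simp only [InIvl]; push_cast; constructor <;> linarith only [h1, h2, hη0, hη]
  have ix : ∀ {t : ℝ}, -51 / 100 ≤ t → t ≤ 1 / 2 + 2 * η →
      InIvl (((-51 : ℚ)) / 100, (502 : ℚ) / 1000) t := fun h1 h2 => by
    simp only [InIvl]; push_cast; constructor <;> linarith only [h1, h2, hη0, hη]
  exact pent_core_false hm2 hm5 hm1 (ix lx1 ux1) (ix lx2 ux2) (iv s12 u12) (iv s23 u23) (iv s34 u34)
    (iv s45 u45) (iv s51 u51) hw2 hw5 hw1
    (fun c' _ => Real.sin_sq_add_cos_sq _) (fun c' _ => Real.sin_sq_add_cos_sq _)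
    (fun c' _ => Real.sin_sq_add_cos_sq _) hprod2 hprod5 hprod1

end Summit.AtomisticToContinuum.Crystallization.Theorems

end
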